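import Summits.ABC.IUTFork.Repair.RHReachLedgerVolume
import Summits.ABC.IUTFork.Repair.RHMultiReachFree
import Summits.ABC.IUTFork.Repair.RHSlotReach
import Summits.ABC.IUTFork.Cor312RegimeVerbatimPrVolSingle
import Summits.ABC.IUTFork.Cor312ArchCornerSign
import HarnessLib

/-!
# R-H ROUND 2, row 27 «reach-ledger» (1/2) — (α) REALISATION: the pooled level weights that carry a REACHED q-idele `t_q·ϖ^{−s}` at
# every packet of `settingPrVolSharp`, and abc-iut-rh-typ-10's L1 (volume form) over abc-iut-rp-d3's BOX-FREE door

PROOF-ONLY file (0 definitions, 0 `Prop` facts; abc-iut cell, D-0079 RESCUE sub-cell R-H, rung LADDER-ABC:A2.RESCUE.H; ROUND-2 seat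
abc-iut-rh2-L1 = row 27's lemma-L1 seat, director-abc g3 TRANCHE 1 AMENDED 19:57:56Z; rh-lead ROUND2/START-HERE §2 «rh2-L1 takes (α)
realisation of the ledger integers by actual movers and (β) the bookkeeping into `statement_iff_avg_cellSlack`» — (β) and the door are the
companion `Repair/RHReachLedgerDoor.lean`). TAKES NO SIDE on [IUTchIII] Cor. 3.12 or on any author; typed ≠ proved; instantiated ≠ endorsed;
nothing here asserts abc proved or refuted. Inputs BY NAME: abc-iut-rh-typ-10's `Repair.RHReachLedgerVolume` (p466959:
`thetaHull_settingPrVolSharp_eq` and the pattern of `reachGain_le_cellSlack`), abc-iut-rp-d3's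
`RHLevelMover.qRegion_subset_thetaHull_settingPrVolSharp_of_levelWeightsAt` (p467833; level mover p461981), abc-iut-c312-7's
`logvol_qRegion_Pr_inr`, abc-iut-w4-d107's `sum_weightPr_mul_ite_last_eq`, abc-iut-c312-1's `card_caps_labelSucc`.

WHAT IS PROVED.
* §1 `sum_weightPr_mul_apply_last` — the LAST-SLOT MARGINAL `Σ_{v⃗} Pr_j(v⃗)·g(v_j) = Σ_{v∣p} (n_v/[F:ℚ])·g(v)`: the packet weight of a place as
  last slot is `n_v/[F:ℚ]` at EVERY label (rh-tst-10's typing condition (L1-b) for row 27: the per-place ledger needs label-independent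
  weights).
* §2 `reachGain_le_cellSlack_of_levelWeightsAt` — typ-10's L1 «reach gain ≤ cell slack» with w5-d107's boxed multi-reach replaced by
  rp-d3's LEVEL WEIGHTS (pooled box: `Π_a p^{−(k_a+1)}‖y_a‖ ≤ ‖t_Θ‖`, only `Σ_a k_a` matters — this is what row 27's per-slot reach
  `D = (e−1)+(c−B)` needs; the boxed door gives only `e − B` per donor slot at a deep place).
* §3 `levelWeightsAt_reached` — (α): for a UNIFORM certified dictionary per prime `(e_p, A_p, B_p)` (`K/ℚ` Galois rows: HEX, G-HEX, lamSeven,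
  frey) and ANY integer surpluses `s(p,i,x)`, `= 0` off `S` and `≤ mq − (i+2)·B − e·⌈(mΘ − (i+2)(A+e−1))/e⌉` at the bad places, the level
  weights `y_a = u_{v_a}` (non-log-units of valuation `≥ A−1`), `z_a = z_{v_a}` (log-units of norm `≥ p^{−B/e}`), `k_a = 0` on donors and
  `k = ⌈(MΘ − (i+2)(A+e−1))/e⌉` on the last slot carry the reached idele `t_q·ϖ^{−s}` at EVERY packet (two-sided: a deficit `s < 0` is the
  same movers with a shrunken target — rh-tst-10's (L1-a); good places silent — (L1-c)).
HONEST SCOPE. OUR typed objects (Dupuy–Hilado (Ind2) = all `ℤ_p`-lattice automorphisms of the log-shell — STRONGER-THAN-PRINT; sharp boxes;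
hull-level (xi-f)); the certificates `(A, B)` are HYPOTHESES here (for the column values `(innerCond, rOutSharp)` see
`RHSlotReach.exists_hsharp_one`, row 20's `RH.LinearReachLaw.isInnerConductor_of_not_dvd`, `RHSlotReach.exists_hrad_sharp`, off the ties).
[cite: DupuyHilado2025, §3.6, §3.9, §4.9] [cite: WeilBNT1967, Ch. II §2, Th. 1]
[cite: Mochizuki2012, IUTchIII Prop. 3.9 (i) p. 116, Rmk. 3.9.3 pp. 119–120, Cor. 3.12 p. 173–174, Step (xi-f) p. 184] [claim: Mochizuki2012, status: disputed]
-/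

noncomputable section

open Set Function
open scoped Pointwise

namespace Summit.ABC.IUTFork.Repair.RH.ReachLedgerRealise

open Cor312 Cor312Vol Literature.IUT.LogThetaLattice Literature.IUT.LogVolume NumberField IsDedekindDomain
  Summit.ABC.IUTFork.Thm311 Summit.ABC.IUTFork.Thm311.Real

section Sharp

variable {F : Type} [Field F] [NumberField F] (X : PilotData F) {logv : PadicLogs F} (hlog : LogvAnalytic logv)
  (M : Type) [Field M] [NumberField M]
  (archPk : ∀ (j : (thetaIndex X).Label) (vQ : (thetaIndex X).VQ), Set ((logShellsDH X logv).Packet j vQ))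
  (archSub : ∀ (j : (thetaIndex X).Label) (v : (thetaIndex X).V),
    Set ((logShellsDH X logv).Packet j ((thetaIndex X).over v)))
  (Ψ : ℤ → ∀ v : (thetaIndex X).V, v ∈ (thetaIndex X).Vbad → Set ((logShellsDH X logv).StarPacket v))
  (act : ℤ → ∀ v : (thetaIndex X).V, v ∈ (thetaIndex X).Vbad →
    (logShellsDH X logv).StarPacket v → Module.End ℚ ((logShellsDH X logv).StarPacket v))
  (Mmod : ℤ → ∀ j : (thetaIndex X).LabelStar, Set ((logShellsDH X logv).GlobalPacket j.1))
  (region : ℤ → ∀ j : (thetaIndex X).LabelStar, FinDivisor M → ∀ vQ : (thetaIndex X).VQ,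
    Set ((logShellsDH X logv).Packet j.1 vQ))
  (n : ℤ) {HT : Type} {LogLink : HT → HT → Type} {IsFull : ∀ {s t : HT}, LogLink s t → Prop}
  (lat : LGPGaussianLogThetaLattice LogLink IsFull)
  {Frd : Type} {IsoF : Frd → Frd → Type} {Ob : Frd → Type} {realify : Frd → Frd} {Strip : Type}
  {IsoS : Strip → Strip → Type} {Mv : ∀ v : (thetaIndex X).V, v ∈ (thetaIndex X).Vbad → Type}
  [∀ v h, Monoid (Mv v h)]
  (sig : GlobalLGPFrobenioidSignature (thetaIndex X).lstar (thetaIndex X).V (· ∈ (thetaIndex X).Vbad)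
    Frd IsoF Ob realify Strip IsoS Mv)
  (split : SplittingMonoids Mv) {ObΔ : Type} {N : ∀ v : (thetaIndex X).V, v ∈ (thetaIndex X).Vbad → Type}
  [∀ v h, Monoid (N v h)] (qData : QPilotData ObΔ N)
  (tq : ∀ (pp : Nat.Primes) (x : (thetaIndex X).Fibre (.inr pp)), haveI : Fact (pp : ℕ).Prime := ⟨pp.2⟩; kOf X pp.1 x)
  (t : ∀ (pp : Nat.Primes) (_ : Fin X.lstar) (x : (thetaIndex X).Fibre (.inr pp)),
    haveI : Fact (pp : ℕ).Prime := ⟨pp.2⟩; kOf X pp.1 x)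
  (htq0 : ∀ pp x, tq pp x ≠ 0)
  (htq1 : ∀ (pp : Nat.Primes) (x : (thetaIndex X).Fibre (.inr pp)),
    haveI : Fact (pp : ℕ).Prime := ⟨pp.2⟩; placeOf X pp.1 x ∉ X.S → ‖tq pp x‖ = 1)

/-! ## §1. The last-slot marginal of the probability weights (rh-tst-10's (L1-b): `W_{x,j} = n_x/[F:ℚ]` does not read `j`) -/

open scoped Classical in
/-- **LAST-SLOT MARGINAL**: `Σ_{v⃗} Pr_j(v⃗)·g(v_j) = Σ_{v ∣ p} (n_v/[F:ℚ])·g(v)` for every real `g` on the fibre over `p` (the fibre read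
as Dupuy–Hilado's `V(F)_p` through abc-iut-c312-5's `fibreEquivPlacesOver`) — the packet weight of the place `v` as LAST slot is `n_v/[F:ℚ]` at
EVERY label `j` (abc-iut-w4-d107's indicator marginal `sum_weightPr_mul_ite_last_eq` summed over the fibre; Dupuy–Hilado
`𝔼(f(v_j) : v⃗) = 𝔼(f(v) : v)`). [cite: DupuyHilado2025, §3.6, Thm. 3.10.1 proof] -/
theorem sum_weightPr_mul_apply_last (pp : Nat.Primes) (j : (thetaIndex X).Label)
    (g : (thetaIndex X).Fibre (.inr pp) → ℝ) :
    haveI : Fact (pp : ℕ).Prime := ⟨pp.2⟩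
    ∑ e : (presAt X hlog pp).toLocalPieces.E j, weightPr X pp.1 j e * g (e (Fin.last _)) =
      ∑ v : ↥(placesOver F pp), weight F v.1 * g ((fibreEquivPlacesOver X pp).symm v) := by
  haveI : Fact (pp : ℕ).Prime := ⟨pp.2⟩
  letI : Fintype ((thetaIndex X).Fibre (.inr pp)) := Fintype.ofEquiv _ (fibreEquivPlacesOver X pp).symm
  have hsplit : ∀ e : (presAt X hlog pp).toLocalPieces.E j,
      weightPr X pp.1 j e * g (e (Fin.last _)) =
        ∑ x : (thetaIndex X).Fibre (.inr pp), weightPr X pp.1 j e * (if e (Fin.last _) = x then g x else 0) := by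
    intro e
    rw [← Finset.mul_sum, Finset.sum_ite_eq]
    simp only [Finset.mem_univ, if_true]
  rw [Finset.sum_congr rfl fun e _ => hsplit e, Finset.sum_comm]
  have hx : ∀ x : (thetaIndex X).Fibre (.inr pp),
      ∑ e : (presAt X hlog pp).toLocalPieces.E j, weightPr X pp.1 j e * (if e (Fin.last _) = x then g x else 0) =
        weight F (placeOf X pp.1 x) * g x := fun x => sum_weightPr_mul_ite_last_eq X hlog pp j x (g x)
  rw [Finset.sum_congr rfl fun x _ => hx x]
  refine Fintype.sum_equiv (fibreEquivPlacesOver X pp) _ _ fun x => ?_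
  show weight F (placeOf X pp.1 x) * g x =
    weight F (fibreEquivPlacesOver X pp x).1 * g ((fibreEquivPlacesOver X pp).symm (fibreEquivPlacesOver X pp x))
  rw [Equiv.symm_apply_apply]
  rfl

/-! ## §2. typ-10's L1 (volume form) over abc-iut-rp-d3's BOX-FREE level-weights door -/

/-- **REACH GAIN ≤ CELL SLACK, over the box-free level-weights door.** At `settingPrVolSharp`, packet `(i+1, p)`: if an idele `t_q'`
(nonzero, units off `S`) is carried by abc-iut-rp-d3's LEVEL WEIGHTS at every summand (non-log-units `y_a`, log-units `z_a`, integers `k_a`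
with `Π_a p^{−(k_a+1)}‖y_a‖ ≤ ‖t_{Θ,i+1,v_last}‖` and `‖t_q'(v_last)‖ ≤ Π_a p^{−k_a}‖z_a‖` — POOLED box, only `Σ_a k_a` matters), then
`Σ_{v⃗} Pr(v⃗)·(log ‖t_q'(v_{i+1})‖ − log ‖t_q(v_{i+1})‖) ≤ σ_{i+1,p} := logvol(ⁿ˒°𝒰_{i+1,p}) − qLocal_{i+1,p}` (abc-iut-rh-typ-10's
`reachGain_le_cellSlack`, with `qRegion_subset_thetaHull_settingPrVolSharp_of_levelWeightsAt` for w5-d107's boxed inclusion).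
[cite: DupuyHilado2025, §3.9, §4.9] [claim: Mochizuki2012, status: disputed] -/
theorem reachGain_le_cellSlack_of_levelWeightsAt (ht0 : ∀ pp i x, t pp i x ≠ 0) (pp : Nat.Primes) (i : Fin (thetaIndex X).lstar)
    (tq' : ∀ (pp : Nat.Primes) (x : (thetaIndex X).Fibre (.inr pp)), haveI : Fact (pp : ℕ).Prime := ⟨pp.2⟩; kOf X pp.1 x)
    (htq0' : ∀ pp x, tq' pp x ≠ 0)
    (htq1' : ∀ (pp : Nat.Primes) (x : (thetaIndex X).Fibre (.inr pp)),
      haveI : Fact (pp : ℕ).Prime := ⟨pp.2⟩; placeOf X pp.1 x ∉ X.S → ‖tq' pp x‖ = 1)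
    (hlev : haveI : Fact (pp : ℕ).Prime := ⟨pp.2⟩
      ∀ e : (thetaIndex X).Caps (Setting.labelSucc i) → (thetaIndex X).Fibre (.inr pp),
        ∃ (y z : ∀ a, kOf X pp.1 (e a)) (k : (thetaIndex X).Caps (Setting.labelSucc i) → ℤ),
          (∀ a, y a ∉ (logUnits (kOf X pp.1 (e a)) : Set (kOf X pp.1 (e a)))) ∧
          (∀ a, z a ∈ (logUnits (kOf X pp.1 (e a)) : Set (kOf X pp.1 (e a)))) ∧
          (∏ a, ((pp : ℕ) : ℝ) ^ (-(k a + 1)) * ‖y a‖ ≤ ‖t pp i (e (Fin.last _))‖) ∧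
          ‖tq' pp (e (Fin.last _))‖ ≤ ∏ a, ((pp : ℕ) : ℝ) ^ (-(k a)) * ‖z a‖)
    (HB : BridgeHyps (settingPrVolSharp X hlog M archPk archSub Ψ act Mmod region n lat sig split qData tq t htq0 htq1)) :
    haveI : Fact (pp : ℕ).Prime := ⟨pp.2⟩
    (∑ e : (presAt X hlog pp).toLocalPieces.E (Setting.labelSucc i),
        weightPr X pp.1 (Setting.labelSucc i) e *
          (Real.log ‖tq' pp (e (Fin.last _))‖ - Real.log ‖tq pp (e (Fin.last _))‖)) ≤
      ((situationPrVol X hlog M archPk archSub Ψ act Mmod region).D n).logvol (Setting.labelSucc i) (.inr pp)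
          ((settingPrVolSharp X hlog M archPk archSub Ψ act Mmod region n lat sig split qData tq t htq0 htq1).thetaHull
            (Setting.labelSucc i) (.inr pp)) -
        (settingPrVolSharp X hlog M archPk archSub Ψ act Mmod region n lat sig split qData tq t htq0 htq1).qLocal
          (Setting.labelSucc i) (.inr pp) := by
  haveI : Fact (pp : ℕ).Prime := ⟨pp.2⟩
  -- the inclusion for the reached idele (rp-d3), in the hull of the original setting (typ-10: the hull does not read `t_q`)
  have hsub : (settingPrVolSharp X hlog M archPk archSub Ψ act Mmod region n lat sig split qData tq' t htq0' htq1').qRegion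
        (Setting.labelSucc i) (.inr pp) ⊆
      (settingPrVolSharp X hlog M archPk archSub Ψ act Mmod region n lat sig split qData tq' t htq0' htq1').thetaHull
        (Setting.labelSucc i) (.inr pp) :=
    RHLevelMover.qRegion_subset_thetaHull_settingPrVolSharp_of_levelWeightsAt X hlog M archPk archSub Ψ act Mmod region n lat sig
      split qData tq' t htq0' htq1' ht0 pp i hlev
  rw [ReachLedgerVolume.thetaHull_settingPrVolSharp_eq X hlog M archPk archSub Ψ act Mmod region n lat sig split qData tq t htq0 htq1
    tq' htq0' htq1'] at hsub
  have hq' : (settingPrVolSharp X hlog M archPk archSub Ψ act Mmod region n lat sig split qData tq' t htq0' htq1').qLocal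
        (Setting.labelSucc i) (.inr pp) =
      ∑ e : (presAt X hlog pp).toLocalPieces.E (Setting.labelSucc i),
        weightPr X pp.1 (Setting.labelSucc i) e * Real.log ‖tq' pp (e (Fin.last _))‖ :=
    logvol_qRegion_Pr_inr X hlog M archPk archSub Ψ act Mmod region n tq' htq0' (Setting.labelSucc i) pp
  have hq : (settingPrVolSharp X hlog M archPk archSub Ψ act Mmod region n lat sig split qData tq t htq0 htq1).qLocal
        (Setting.labelSucc i) (.inr pp) =
      ∑ e : (presAt X hlog pp).toLocalPieces.E (Setting.labelSucc i),
        weightPr X pp.1 (Setting.labelSucc i) e * Real.log ‖tq pp (e (Fin.last _))‖ :=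
    logvol_qRegion_Pr_inr X hlog M archPk archSub Ψ act Mmod region n tq htq0 (Setting.labelSucc i) pp
  have hle : (settingPrVolSharp X hlog M archPk archSub Ψ act Mmod region n lat sig split qData tq' t htq0' htq1').qLocal
        (Setting.labelSucc i) (.inr pp) ≤
      ((situationPrVol X hlog M archPk archSub Ψ act Mmod region).D n).logvol (Setting.labelSucc i) (.inr pp)
        ((settingPrVolSharp X hlog M archPk archSub Ψ act Mmod region n lat sig split qData tq t htq0 htq1).thetaHull
          (Setting.labelSucc i) (.inr pp)) :=
    HB.mono i (.inr pp)
      ((settingPrVolSharp X hlog M archPk archSub Ψ act Mmod region n lat sig split qData tq' t htq0' htq1').hul_adm _ _ _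
        ((settingPrVolSharp X hlog M archPk archSub Ψ act Mmod region n lat sig split qData tq' t htq0' htq1').qRegion_mem _ _))
      ((settingPrVolSharp X hlog M archPk archSub Ψ act Mmod region n lat sig split qData tq t htq0 htq1).thetaHull_adm
        (Cor312Vol.hullDefined_of_thetaFinite HB.finite i (.inr pp))) hsub
  rw [hq', hq] at *
  simp only [mul_sub, Finset.sum_sub_distrib]
  linarith [hle]

/-! ## §3. (α) THE LEVEL WEIGHTS THAT REALISE A SURPLUS `s` (uniform dictionary; pooled box; two-sided) -/

section Dictionary

variable (eK AK : Nat.Primes → ℕ) (BK : Nat.Primes → ℤ)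
  (ϖ : ∀ (pp : Nat.Primes) (x : (thetaIndex X).Fibre (.inr pp)), haveI : Fact (pp : ℕ).Prime := ⟨pp.2⟩; kOf X pp.1 x)
  (mΘ : ∀ pp : Nat.Primes, Fin (thetaIndex X).lstar → (thetaIndex X).Fibre (.inr pp) → ℤ)
  (mq : ∀ pp : Nat.Primes, (thetaIndex X).Fibre (.inr pp) → ℤ)
  (s : ∀ pp : Nat.Primes, Fin (thetaIndex X).lstar → (thetaIndex X).Fibre (.inr pp) → ℤ)
/-- `‖ϖ_x‖^m = p^{−m/e}` for a norm uniformizer with `‖ϖ_x‖ = p^{−1/e}`. [folklore] -/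
theorem norm_varpi_zpow (pp : Nat.Primes)
    (hϖ : ∀ x : (thetaIndex X).Fibre (.inr pp), haveI : Fact (pp : ℕ).Prime := ⟨pp.2⟩
      ‖ϖ pp x‖ = ((pp : ℕ) : ℝ) ^ (-(1 : ℝ) / (eK pp : ℝ)))
    (x : (thetaIndex X).Fibre (.inr pp)) (m : ℤ) :
    haveI : Fact (pp : ℕ).Prime := ⟨pp.2⟩
    ‖ϖ pp x‖ ^ m = ((pp : ℕ) : ℝ) ^ (-(m : ℝ) / (eK pp : ℝ)) := by
  haveI : Fact (pp : ℕ).Prime := ⟨pp.2⟩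
  have hp0 : (0 : ℝ) < (pp : ℕ) := by exact_mod_cast pp.2.pos
  rw [← Real.rpow_intCast, hϖ x, ← Real.rpow_mul hp0.le]
  congr 1; ring

include htq0 in
/-- The reached idele `t_q·ϖ^{−s}` is nonzero. [folklore] -/
theorem reached_ne_zero
    (hϖ : ∀ (pp : Nat.Primes) (x : (thetaIndex X).Fibre (.inr pp)), haveI : Fact (pp : ℕ).Prime := ⟨pp.2⟩
      ‖ϖ pp x‖ = ((pp : ℕ) : ℝ) ^ (-(1 : ℝ) / (eK pp : ℝ)))
    (i : Fin (thetaIndex X).lstar) (pp : Nat.Primes) (x : (thetaIndex X).Fibre (.inr pp)) :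
    haveI : Fact (pp : ℕ).Prime := ⟨pp.2⟩
    tq pp x * ϖ pp x ^ (-(s pp i x)) ≠ 0 := by
  haveI : Fact (pp : ℕ).Prime := ⟨pp.2⟩
  have hp0 : (0 : ℝ) < (pp : ℕ) := by exact_mod_cast pp.2.pos
  have hϖ0 : ϖ pp x ≠ 0 := by rw [← norm_pos_iff, hϖ pp x]; exact Real.rpow_pos_of_pos hp0 _
  exact mul_ne_zero (htq0 pp x) (zpow_ne_zero _ hϖ0)

include htq1 in
/-- The reached idele is a unit off `S` when the surplus vanishes there (rh-tst-10's (L1-c): silent good places). [folklore] -/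
theorem norm_reached_eq_one_of_good
    (hs0 : ∀ (pp : Nat.Primes) (i : Fin (thetaIndex X).lstar) (x : (thetaIndex X).Fibre (.inr pp)),
      haveI : Fact (pp : ℕ).Prime := ⟨pp.2⟩; placeOf X pp.1 x ∉ X.S → s pp i x = 0)
    (i : Fin (thetaIndex X).lstar) (pp : Nat.Primes) (x : (thetaIndex X).Fibre (.inr pp)) :
    haveI : Fact (pp : ℕ).Prime := ⟨pp.2⟩
    placeOf X pp.1 x ∉ X.S → ‖tq pp x * ϖ pp x ^ (-(s pp i x))‖ = 1 := by
  haveI : Fact (pp : ℕ).Prime := ⟨pp.2⟩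
  intro hx
  rw [hs0 pp i x hx, neg_zero, zpow_zero, mul_one]
  exact htq1 pp x hx

include htq1 in
/-- **(α) REALISATION: the pooled level weights that carry the reached idele `t_q·ϖ^{−s}` at EVERY packet.** Uniform certified dictionary
per prime `p`: absolute index `e_p ≥ 1`, a norm uniformizer `ϖ_x` (`‖ϖ_x‖ = p^{−1/e_p}`), an inner certificate `A_p` (a NON-log-unit `u_x` with
`‖u_x‖ ≤ ‖ϖ_x‖^{A_p−1}` at every `x ∣ p`, i.e. `A_p ≤ r_in`), an outer certificate `B_p ≤ A_p` (a log-unit `z_x` with `‖z_x‖ ≥ p^{−B_p/e_p}`), the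
Θ- and q-orders `mΘ`, `mq` at the bad places (`t`, `t_q` units off `S`). For ANY integers `s(p,i,x)`, `= 0` off `S` and at the bad `w`
`s ≤ mq − (i+2)·B − e·⌈(mΘ − (i+2)(A+e−1))/e⌉` (= `cellReachSlack + 1` when `mΘ = (i+1)²·mq`, `(A,B) = (innerCond, rOutSharp)`, §0), the data of
abc-iut-rp-d3's `qRegion_subset_thetaHull_settingPrVolSharp_of_levelWeightsAt` exist at the packet `(i+1, p)` for the idele `t_q·ϖ^{−s(p,i,·)}`:
`y_a = u_{v_a}`, `z_a = z_{v_a}`, `k_a = 0` on the donor slots and `k = ⌈(MΘ − (i+2)(A+e−1))/e⌉` on the last slot (`MΘ = mΘ` at a bad last place,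
`0` at a good one). Two-sided: a deficit `s < 0` is the same movers with a shrunken target. [cite: DupuyHilado2025, §3.9, §4.9]
[cite: WeilBNT1967, Ch. II §2, Th. 1] [claim: Mochizuki2012, status: disputed] -/
theorem levelWeightsAt_reached (he : ∀ pp, 1 ≤ eK pp) (hBA : ∀ pp, BK pp ≤ (AK pp : ℤ))
    (hϖ : ∀ (pp : Nat.Primes) (x : (thetaIndex X).Fibre (.inr pp)), haveI : Fact (pp : ℕ).Prime := ⟨pp.2⟩
      ‖ϖ pp x‖ = ((pp : ℕ) : ℝ) ^ (-(1 : ℝ) / (eK pp : ℝ)))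
    (hsharp : ∀ (pp : Nat.Primes) (x : (thetaIndex X).Fibre (.inr pp)), haveI : Fact (pp : ℕ).Prime := ⟨pp.2⟩
      ∃ u : kOf X pp.1 x, ‖u‖ ≤ ‖ϖ pp x‖ ^ ((AK pp : ℤ) - 1) ∧ u ∉ (logUnits (kOf X pp.1 x) : Set (kOf X pp.1 x)))
    (hrad : ∀ (pp : Nat.Primes) (x : (thetaIndex X).Fibre (.inr pp)), haveI : Fact (pp : ℕ).Prime := ⟨pp.2⟩
      ∃ z ∈ (logUnits (kOf X pp.1 x) : Set (kOf X pp.1 x)), ((pp : ℕ) : ℝ) ^ (-(BK pp : ℝ) / (eK pp : ℝ)) ≤ ‖z‖)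
    (ht1 : ∀ (pp : Nat.Primes) (i : Fin X.lstar) (x : (thetaIndex X).Fibre (.inr pp)),
      haveI : Fact (pp : ℕ).Prime := ⟨pp.2⟩; placeOf X pp.1 x ∉ X.S → ‖t pp i x‖ = 1)
    (hΘ : ∀ (pp : Nat.Primes) (i : Fin X.lstar) (w : (thetaIndex X).Fibre (.inr pp)), haveI : Fact (pp : ℕ).Prime := ⟨pp.2⟩
      placeOf X pp.1 w ∈ X.S → ‖t pp i w‖ = ‖ϖ pp w‖ ^ (mΘ pp i w))
    (hq : ∀ (pp : Nat.Primes) (w : (thetaIndex X).Fibre (.inr pp)), haveI : Fact (pp : ℕ).Prime := ⟨pp.2⟩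
      placeOf X pp.1 w ∈ X.S → ‖tq pp w‖ = ‖ϖ pp w‖ ^ (mq pp w))
    (hs0 : ∀ (pp : Nat.Primes) (i : Fin (thetaIndex X).lstar) (x : (thetaIndex X).Fibre (.inr pp)),
      haveI : Fact (pp : ℕ).Prime := ⟨pp.2⟩; placeOf X pp.1 x ∉ X.S → s pp i x = 0)
    (hs : ∀ (pp : Nat.Primes) (i : Fin (thetaIndex X).lstar) (w : (thetaIndex X).Fibre (.inr pp)),
      haveI : Fact (pp : ℕ).Prime := ⟨pp.2⟩; placeOf X pp.1 w ∈ X.S →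
        s pp i w ≤ mq pp w - ((i : ℤ) + 2) * BK pp -
          (eK pp : ℤ) * (-((-(mΘ pp i w - ((i : ℤ) + 2) * ((AK pp : ℤ) + eK pp - 1))) / (eK pp : ℤ))))
    (pp : Nat.Primes) (i : Fin (thetaIndex X).lstar)
    (e : (thetaIndex X).Caps (Setting.labelSucc i) → (thetaIndex X).Fibre (.inr pp)) :
    haveI : Fact (pp : ℕ).Prime := ⟨pp.2⟩
    ∃ (y z : ∀ a, kOf X pp.1 (e a)) (k : (thetaIndex X).Caps (Setting.labelSucc i) → ℤ),
      (∀ a, y a ∉ (logUnits (kOf X pp.1 (e a)) : Set (kOf X pp.1 (e a)))) ∧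
      (∀ a, z a ∈ (logUnits (kOf X pp.1 (e a)) : Set (kOf X pp.1 (e a)))) ∧
      (∏ a, ((pp : ℕ) : ℝ) ^ (-(k a + 1)) * ‖y a‖ ≤ ‖t pp i (e (Fin.last _))‖) ∧
      ‖tq pp (e (Fin.last _)) * ϖ pp (e (Fin.last _)) ^ (-(s pp i (e (Fin.last _))))‖ ≤
        ∏ a, ((pp : ℕ) : ℝ) ^ (-(k a)) * ‖z a‖ := by
  haveI : Fact (pp : ℕ).Prime := ⟨pp.2⟩
  classical
  have hp1 : (1 : ℝ) < (pp : ℕ) := by exact_mod_cast pp.2.one_lt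
  have hp0 : (0 : ℝ) < (pp : ℕ) := by positivity
  have he0 : (0 : ℝ) < (eK pp : ℝ) := by exact_mod_cast he pp
  have he1 : (1 : ℤ) ≤ (eK pp : ℤ) := by exact_mod_cast he pp
  choose u hu_norm hu_not using hsharp pp
  choose z hz_mem hz_norm using hrad pp
  set w := e (Fin.last _) with hw
  have hϖ0 : ϖ pp w ≠ 0 := by rw [← norm_pos_iff, hϖ pp w]; exact Real.rpow_pos_of_pos hp0 _
  -- uniform reading of the two idele orders at the last place (`MΘ = Mq = 0` at a good place)
  obtain ⟨MΘ, Mq, hMΘ, hMq, hsle⟩ : ∃ MΘ Mq : ℤ, ‖t pp i w‖ = ‖ϖ pp w‖ ^ MΘ ∧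
      ‖tq pp w * ϖ pp w ^ (-(s pp i w))‖ = ‖ϖ pp w‖ ^ (Mq - s pp i w) ∧
      s pp i w ≤ Mq - ((i : ℤ) + 2) * BK pp -
        (eK pp : ℤ) * (-((-(MΘ - ((i : ℤ) + 2) * ((AK pp : ℤ) + eK pp - 1))) / (eK pp : ℤ))) := by
    by_cases hbad : placeOf X pp.1 w ∈ X.S
    · refine ⟨mΘ pp i w, mq pp w, hΘ pp i w hbad, ?_, hs pp i w hbad⟩
      rw [norm_mul, norm_zpow, hq pp w hbad, ← zpow_add₀ (norm_ne_zero_iff.mpr hϖ0), sub_eq_add_neg]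
    · refine ⟨0, 0, ?_, ?_, ?_⟩
      · rw [zpow_zero]; exact ht1 pp i w hbad
      · rw [hs0 pp i w hbad, neg_zero, zpow_zero, mul_one, sub_zero, zpow_zero]; exact htq1 pp w hbad
      · rw [hs0 pp i w hbad]
        have h1 := RHLevelMover.mul_neg_ediv_neg_le (eK pp) (he pp) (0 - ((i : ℤ) + 2) * ((AK pp : ℤ) + eK pp - 1))
        have hi : (0 : ℤ) ≤ (i : ℤ) := by positivity
        have h2 : 0 ≤ ((i : ℤ) + 2) * ((AK pp : ℤ) - BK pp) := mul_nonneg (by linarith) (sub_nonneg.mpr (hBA pp))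
        have h3 : 0 ≤ ((i : ℤ) + 1) * ((eK pp : ℤ) - 1) := mul_nonneg (by linarith) (by linarith)
        nlinarith [h1, h2, h3]
  -- the pooled level count, carried by the last slot
  set K : ℤ := -((-(MΘ - ((i : ℤ) + 2) * ((AK pp : ℤ) + eK pp - 1))) / (eK pp : ℤ)) with hK
  have hKY : MΘ - ((i : ℤ) + 2) * ((AK pp : ℤ) + eK pp - 1) ≤ (eK pp : ℤ) * K := RHSlotReach.le_mul_ceilDiv he1 _
  set k : (thetaIndex X).Caps (Setting.labelSucc i) → ℤ := fun a => if a = Fin.last _ then K else 0 with hkdef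
  have hksum : ∑ a, k a = K := by
    show ∑ a, (if a = Fin.last _ then K else 0) = K
    rw [Finset.sum_ite_eq']
    simp only [Finset.mem_univ, if_true]
  have hcard : (Finset.univ : Finset ((thetaIndex X).Caps (Setting.labelSucc i))).card = (i : ℕ) + 2 := by
    rw [Finset.card_univ, card_caps_labelSucc]
  -- norms in `p`-exponent form
  have hϖzpow := norm_varpi_zpow X eK ϖ pp (hϖ pp)
  have hzpow_rpow : ∀ m : ℤ, ((pp : ℕ) : ℝ) ^ m = ((pp : ℕ) : ℝ) ^ (((m * (eK pp : ℤ) : ℤ) : ℝ) / (eK pp : ℝ)) := by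
    intro m
    rw [← Real.rpow_intCast]
    congr 1
    push_cast
    field_simp
  have hu_le : ∀ x, ‖u x‖ ≤ ((pp : ℕ) : ℝ) ^ (-(((AK pp : ℤ) - 1 : ℤ) : ℝ) / (eK pp : ℝ)) := fun x => by
    have h := hu_norm x; rwa [hϖzpow] at h
  refine ⟨fun a => u (e a), fun a => z (e a), k, fun a => hu_not (e a), fun a => hz_mem (e a), ?_, ?_⟩
  · -- THE POOLED BOX: `Π_a p^{−(k_a+1)}·‖u_{v_a}‖ ≤ p^{(−(K+i+2)·e − (i+2)(A−1))/e} ≤ p^{−MΘ/e} = ‖t_{Θ,i+1,w}‖`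
    have hfac : ∀ a, ((pp : ℕ) : ℝ) ^ (-(k a + 1)) * ‖u (e a)‖ ≤
        ((pp : ℕ) : ℝ) ^ ((((-(k a + 1)) * (eK pp : ℤ) - ((AK pp : ℤ) - 1) : ℤ) : ℝ) / (eK pp : ℝ)) := by
      intro a
      calc ((pp : ℕ) : ℝ) ^ (-(k a + 1)) * ‖u (e a)‖
          ≤ ((pp : ℕ) : ℝ) ^ (-(k a + 1)) * ((pp : ℕ) : ℝ) ^ (-(((AK pp : ℤ) - 1 : ℤ) : ℝ) / (eK pp : ℝ)) :=
            mul_le_mul_of_nonneg_left (hu_le (e a)) (zpow_nonneg hp0.le _)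
        _ = ((pp : ℕ) : ℝ) ^ ((((-(k a + 1)) * (eK pp : ℤ) - ((AK pp : ℤ) - 1) : ℤ) : ℝ) / (eK pp : ℝ)) := by
            rw [hzpow_rpow, ← Real.rpow_add hp0]
            congr 1
            push_cast
            ring
    have hsum : (∑ a, ((-(k a + 1)) * (eK pp : ℤ) - ((AK pp : ℤ) - 1))) ≤ -MΘ := by
      have hrw : ∀ a, (-(k a + 1)) * (eK pp : ℤ) - ((AK pp : ℤ) - 1) =
          -(eK pp : ℤ) * k a + (-(eK pp : ℤ) - ((AK pp : ℤ) - 1)) := fun a => by ring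
      simp only [hrw, Finset.sum_add_distrib, ← Finset.mul_sum, hksum, Finset.sum_const, hcard, nsmul_eq_mul]
      push_cast
      linarith [hKY]
    calc ∏ a, ((pp : ℕ) : ℝ) ^ (-(k a + 1)) * ‖u (e a)‖
        ≤ ∏ a, ((pp : ℕ) : ℝ) ^ ((((-(k a + 1)) * (eK pp : ℤ) - ((AK pp : ℤ) - 1) : ℤ) : ℝ) / (eK pp : ℝ)) :=
          Finset.prod_le_prod (fun a _ => mul_nonneg (zpow_nonneg hp0.le _) (norm_nonneg _)) fun a _ => hfac a
      _ = ((pp : ℕ) : ℝ) ^ (∑ a, (((-(k a + 1)) * (eK pp : ℤ) - ((AK pp : ℤ) - 1) : ℤ) : ℝ) / (eK pp : ℝ)) :=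
          (Real.rpow_sum_of_pos hp0 _ _).symm
      _ ≤ ((pp : ℕ) : ℝ) ^ (-(MΘ : ℝ) / (eK pp : ℝ)) := by
          refine Real.rpow_le_rpow_of_exponent_le hp1.le ?_
          rw [← Finset.sum_div]
          refine div_le_div_of_nonneg_right ?_ he0.le
          exact_mod_cast hsum
      _ = ‖t pp i w‖ := by rw [hMΘ, hϖzpow]
  · -- THE REACH: `‖t_q·ϖ^{−s}‖ = p^{−(Mq−s)/e} ≤ p^{(−K·e − (i+2)·B)/e} ≤ Π_a p^{−k_a}·‖z_{v_a}‖`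
    have hfac : ∀ a, ((pp : ℕ) : ℝ) ^ ((((-(k a)) * (eK pp : ℤ) - BK pp : ℤ) : ℝ) / (eK pp : ℝ)) ≤
        ((pp : ℕ) : ℝ) ^ (-(k a)) * ‖z (e a)‖ := by
      intro a
      calc ((pp : ℕ) : ℝ) ^ ((((-(k a)) * (eK pp : ℤ) - BK pp : ℤ) : ℝ) / (eK pp : ℝ))
          = ((pp : ℕ) : ℝ) ^ (-(k a)) * ((pp : ℕ) : ℝ) ^ (-(BK pp : ℝ) / (eK pp : ℝ)) := by
            rw [hzpow_rpow, ← Real.rpow_add hp0]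
            congr 1
            push_cast
            ring
        _ ≤ ((pp : ℕ) : ℝ) ^ (-(k a)) * ‖z (e a)‖ := mul_le_mul_of_nonneg_left (hz_norm (e a)) (zpow_nonneg hp0.le _)
    have hsum : -(Mq - s pp i w) ≤ ∑ a, ((-(k a)) * (eK pp : ℤ) - BK pp) := by
      have hrw : ∀ a, (-(k a)) * (eK pp : ℤ) - BK pp = -(eK pp : ℤ) * k a + (-(BK pp)) := fun a => by ring
      simp only [hrw, Finset.sum_add_distrib, ← Finset.mul_sum, hksum, Finset.sum_const, hcard, nsmul_eq_mul]
      push_cast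
      linarith [hsle]
    calc ‖tq pp w * ϖ pp w ^ (-(s pp i w))‖
        = ((pp : ℕ) : ℝ) ^ (-((Mq - s pp i w : ℤ) : ℝ) / (eK pp : ℝ)) := by rw [hMq, hϖzpow]
      _ ≤ ((pp : ℕ) : ℝ) ^ (∑ a, (((-(k a)) * (eK pp : ℤ) - BK pp : ℤ) : ℝ) / (eK pp : ℝ)) := by
          refine Real.rpow_le_rpow_of_exponent_le hp1.le ?_
          rw [← Finset.sum_div]
          refine div_le_div_of_nonneg_right ?_ he0.le
          exact_mod_cast hsum
      _ = ∏ a, ((pp : ℕ) : ℝ) ^ ((((-(k a)) * (eK pp : ℤ) - BK pp : ℤ) : ℝ) / (eK pp : ℝ)) :=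
          Real.rpow_sum_of_pos hp0 _ _
      _ ≤ ∏ a, ((pp : ℕ) : ℝ) ^ (-(k a)) * ‖z (e a)‖ :=
          Finset.prod_le_prod (fun a _ => (Real.rpow_pos_of_pos hp0 _).le) fun a _ => hfac a


end Dictionary

end Sharp

end Summit.ABC.IUTFork.Repair.RH.ReachLedgerRealise

end
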